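import Literature.NumberTheory.LFunctions.Zhang2022.ObjectiveTwinEllK0Plane

/-!
# Zhang (2022) design-space objective, twin part 14: the `K₀`-plane GAIN — the `1/A` coefficient of the physical-frame
# main term is the exact Hermitian form `4π(1+τ₀)·|a − b|²` (matrix `4π(1+τ₀)·[[1,−1],[−1,1]]` on `(k₁+k₂, k₂+k₃)`)

Y. Zhang, *Discrete mean estimates and the Landau–Siegel zero*, arXiv:2211.02515v1 (2022)
[Zhang2022LandauSiegel] — an unrefereed manuscript under adjudication. **This file SEARCHES and TYPES; it
makes no claim about Landau–Siegel zeros, about Theorems 1–2 of the manuscript, or about a repaired (2.32),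
until a kernel theorem says so.** LANDAU–SIEGEL programme, cell `landau-siegel`, §A Lean twin; B-ell block «K₀»,
plane form of record (REF-B2 2026-08-26T21:18:07Z (r1), ls-Bell-plan 21:21:27Z/22:03:23Z): the first-order `2×2` test
«`H(λ,c′) = A·Φ + G₀ + λG₁ + c′G₂ ⪰ 0` on the box» takes as its main-term entry the limit `A·Φ_lim` of `A` times the
sheet main term `phiLimC A C u` (part 10) on the plane `u = a·(k₁+k₂) + b·(k₂+k₃)`. Two numeric lineages print
`A·Φ_lim = 4π(1+τ₀)·[[1,−1],[−1,1]]` (ls-Bell-num-2 kit j260527, ls-obj-eng-1 evaluator-A v1.20 kit j260462 / K0-PLANE-A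
j260569); parts 10/13 had it only as a docstring remark. Here it is a kernel identity, EXACT AT EVERY FINITE `A`:

* `ellFormQ_plane_one_sub` — the pencil at `ℓ = 1 − η` on the plane ordered by powers of `η`:
  `η·(8π(|a−b|² + η[(9η−5)|a|² + (5η+7)|b|² + (6η+4)Re(ab̄)]) − 256η²·Im(ab̄))`;
* `A_mul_phiLimC_plane` — with `ε = (C+½)/(A+C+½)` (`= (1+τ₀)/(2A+1+τ₀)`, `τ₀ = 2C`),
  `A·phiLimC A C u = (C + ½ + ε/2)·(8π(|a−b|² + ε[…]) − 256ε²·Im(ab̄))` — a POLYNOMIAL in `ε`, whose value at `ε = 0`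
  is the gain form `8π(C+½)|a−b|² = 4π(1+τ₀)|a−b|²` (`gainForm_eq`: `= 4π(1+τ₀)(|a|² + |b|² − 2Re(ab̄))`, i.e. the real
  symmetric matrix `4π(1+τ₀)[[1,−1],[−1,1]]`, rank one, null along `a = b` = `u* = k₁+2k₂+k₃`);
* `tendsto_A_mul_phiLimC_plane` — `A·phiLimC A C u → 4π(1+2C)|a−b|²` as `A → ∞` (every `C ≥ 0`);
* the three rows of record: `tendsto_A_mul_phiLimC_k13/k12/k23` (`→ 16π(1+2C), 4π(1+2C), 4π(1+2C)`), and `u*`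
  (`tendsto_A_mul_phiLimC_uStar : → 0`).

So on the `K₀` plane the main-term side of test #1 is kernel at BOTH orders: order `A⁰` — `≥ 0` and singular along `u*`
(parts 7/8/13: `mainTerm_frame_nonneg`, `ellFormQ_plane_nonneg`, `phiLimC_uStar`); order `A⁻¹` — the exact gain form (this
part). What is NOT here: the dictionary matrices `G₀, G₁, G₂` (`D`, `Φ`, `G₁` of B-ell/deriv-1/D-ELL-1-K0.md; registry row
E-022, derivation) — they are parameters of ls-Bell-typer-2's rows, not objects of the main-term calculus.
Theorems only; no new definitions.
-/

noncomputable section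

open Real Complex ComplexConjugate Filter Topology

namespace Literature.NumberTheory.LFunctions.Zhang2022

namespace EllRegime

open EllScales Objective

/-- `‖z‖² = Re² + Im²`. [folklore] -/
private theorem normSq_re_im₃ (z : ℂ) : ‖z‖ ^ 2 = z.re ^ 2 + z.im ^ 2 := by
  rw [Complex.sq_norm, Complex.normSq_apply]; ring

/-- `‖a − b‖² = ‖a‖² + ‖b‖² − 2·Re(a b̄)`. [folklore] -/
private theorem norm_sub_sq_eq_re (a b : ℂ) : ‖a - b‖ ^ 2 = ‖a‖ ^ 2 + ‖b‖ ^ 2 - 2 * (a * conj b).re := by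
  rw [normSq_re_im₃, normSq_re_im₃ a, normSq_re_im₃ b]
  simp only [Complex.sub_re, Complex.sub_im, Complex.mul_re, Complex.conj_re, Complex.conj_im]
  ring

/-- **The pencil at `ℓ = 1 − η` on the plane, by powers of `η`**:
`ellFormQ (1−η) a (a+b) b = η·(8π(‖a−b‖² + η((9η−5)‖a‖² + (5η+7)‖b‖² + (6η+4)Re(ab̄))) − 256η²·Im(ab̄))` — leading term
`8πη‖a−b‖²` (`= η·N(1)`, part 13), everything else `O(η²)`. [cite: Zhang2022LandauSiegel, §2 (2.10), (2.13), (2.23)–(2.25)] -/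
theorem ellFormQ_plane_one_sub (η : ℝ) (a b : ℂ) :
    ellFormQ (1 - η) a (a + b) b =
      η * (8 * π * (‖a - b‖ ^ 2
              + η * ((9 * η - 5) * ‖a‖ ^ 2 + (5 * η + 7) * ‖b‖ ^ 2 + (6 * η + 4) * (a * conj b).re))
            - 256 * η ^ 2 * (a * conj b).im) := by
  rw [ellFormQ_plane, norm_sub_sq_eq_re]
  ring

/-- **GAIN IDENTITY (exact, every finite `A`)**: with `ε = (C+½)/(A+C+½)`,
`A·phiLimC A C (a(k₁+k₂) + b(k₂+k₃)) = (C + ½ + ε/2)·(8π(‖a−b‖² + ε(…)) − 256ε²·Im(ab̄))` — `A` times the sheet main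
term is a polynomial in `ε` (`(A+C+1)·ε = C + ½ + ε/2`). [cite: Zhang2022LandauSiegel, §2 (2.8), (2.10), (2.13), (2.30)] -/
theorem A_mul_phiLimC_plane {A C : ℝ} (hA : 0 < A) (hC : 0 ≤ C) (a b : ℂ) :
    A * phiLimC A C ![-a, a + b, -b] =
      (C + 1 / 2 + (C + 1 / 2) / (A + C + 1 / 2) / 2) *
        (8 * π * (‖a - b‖ ^ 2
              + (C + 1 / 2) / (A + C + 1 / 2) *
                ((9 * ((C + 1 / 2) / (A + C + 1 / 2)) - 5) * ‖a‖ ^ 2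
                  + (5 * ((C + 1 / 2) / (A + C + 1 / 2)) + 7) * ‖b‖ ^ 2
                  + (6 * ((C + 1 / 2) / (A + C + 1 / 2)) + 4) * (a * conj b).re))
          - 256 * ((C + 1 / 2) / (A + C + 1 / 2)) ^ 2 * (a * conj b).im) := by
  have h : A + C + 1 / 2 ≠ 0 := by linarith
  rw [phiLimC_plane, sheet_ratio_eq h, ellFormQ_plane_one_sub]
  set ε : ℝ := (C + 1 / 2) / (A + C + 1 / 2) with hε
  set Y : ℝ := 8 * π * (‖a - b‖ ^ 2 + ε * ((9 * ε - 5) * ‖a‖ ^ 2 + (5 * ε + 7) * ‖b‖ ^ 2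
      + (6 * ε + 4) * (a * conj b).re)) - 256 * ε ^ 2 * (a * conj b).im
  have hAe : (A + C + 1) * ε = C + 1 / 2 + ε / 2 := by
    rw [hε]; field_simp; ring
  calc A * ((A + C + 1) / A * (ε * Y)) = ((A + C + 1) * ε) * Y := by field_simp
    _ = (C + 1 / 2 + ε / 2) * Y := by rw [hAe]

/-- The gain form as a matrix entry: `4π(1+2C)‖a−b‖² = 4π(1+2C)(‖a‖² + ‖b‖² − 2Re(ab̄))` — the real symmetric `2×2` form
`4π(1+τ₀)·[[1,−1],[−1,1]]` on `(k₁+k₂, k₂+k₃)` (rank one; null along `a = b`, i.e. `u* = k₁+2k₂+k₃`).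
[cite: Zhang2022LandauSiegel, §2 (2.8), (2.10), (2.13)] -/
theorem gainForm_eq (C : ℝ) (a b : ℂ) :
    4 * π * (1 + 2 * C) * ‖a - b‖ ^ 2 =
      4 * π * (1 + 2 * C) * (‖a‖ ^ 2 + ‖b‖ ^ 2 - 2 * (a * conj b).re) := by
  rw [norm_sub_sq_eq_re]

/-- **THE GAIN**: `A·phiLimC A C (a(k₁+k₂) + b(k₂+k₃)) → 4π(1+2C)‖a − b‖²` as `A → ∞` (`C ≥ 0` fixed; `1 + 2C = 1 + τ₀`).
[cite: Zhang2022LandauSiegel, §2 (2.8), (2.10), (2.13), (2.30)] -/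
theorem tendsto_A_mul_phiLimC_plane {C : ℝ} (hC : 0 ≤ C) (a b : ℂ) :
    Tendsto (fun A : ℝ => A * phiLimC A C ![-a, a + b, -b]) atTop
      (𝓝 (4 * π * (1 + 2 * C) * ‖a - b‖ ^ 2)) := by
  -- the polynomial in `ε` of `A_mul_phiLimC_plane`, as a function of `ε`
  let P : ℝ → ℝ := fun e =>
    (C + 1 / 2 + e / 2) *
      (8 * π * (‖a - b‖ ^ 2 + e * ((9 * e - 5) * ‖a‖ ^ 2 + (5 * e + 7) * ‖b‖ ^ 2 + (6 * e + 4) * (a * conj b).re))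
        - 256 * e ^ 2 * (a * conj b).im)
  have hP : Continuous P := by fun_prop
  -- `ε(A) = (C+½)/(A+C+½) → 0`
  have hε : Tendsto (fun A : ℝ => (C + 1 / 2) / (A + C + 1 / 2)) atTop (𝓝 0) := by
    apply Tendsto.div_atTop tendsto_const_nhds
    exact tendsto_atTop_add_const_right _ _ (tendsto_atTop_add_const_right _ _ tendsto_id)
  have hlim : Tendsto (fun A : ℝ => P ((C + 1 / 2) / (A + C + 1 / 2))) atTop (𝓝 (P 0)) :=
    (hP.tendsto 0).comp hε
  have hP0 : P 0 = 4 * π * (1 + 2 * C) * ‖a - b‖ ^ 2 := by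
    simp only [P]; ring
  rw [← hP0]
  refine hlim.congr' ?_
  filter_upwards [eventually_gt_atTop (0:ℝ)] with A hA
  exact (A_mul_phiLimC_plane hA hC a b).symm

/-- Row «K₀-POS-001» (`k₁ − k₃ = e₁ − e₂`, `a = 1, b = −1`): `A·phiLimC → 16π(1+2C)`.
[cite: Zhang2022LandauSiegel, §2 (2.8), (2.10), (2.13), (2.30)] -/
theorem tendsto_A_mul_phiLimC_k13 {C : ℝ} (hC : 0 ≤ C) :
    Tendsto (fun A : ℝ => A * phiLimC A C ![-1, 0, 1]) atTop (𝓝 (16 * π * (1 + 2 * C))) := by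
  have h := tendsto_A_mul_phiLimC_plane hC 1 (-1)
  norm_num at h
  convert h using 2
  ring

/-- Row «K₀-POS-002» (`k₁ + k₂ = e₁`, `a = 1, b = 0`): `A·phiLimC → 4π(1+2C)`.
[cite: Zhang2022LandauSiegel, §2 (2.8), (2.10), (2.13), (2.30)] -/
theorem tendsto_A_mul_phiLimC_k12 {C : ℝ} (hC : 0 ≤ C) :
    Tendsto (fun A : ℝ => A * phiLimC A C ![-1, 1, 0]) atTop (𝓝 (4 * π * (1 + 2 * C))) := by
  have h := tendsto_A_mul_phiLimC_plane hC 1 0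
  norm_num at h
  exact h

/-- Row «K₀-POS-003» (`k₂ + k₃ = e₂`, `a = 0, b = 1`): `A·phiLimC → 4π(1+2C)`.
[cite: Zhang2022LandauSiegel, §2 (2.8), (2.10), (2.13), (2.30)] -/
theorem tendsto_A_mul_phiLimC_k23 {C : ℝ} (hC : 0 ≤ C) :
    Tendsto (fun A : ℝ => A * phiLimC A C ![0, 1, -1]) atTop (𝓝 (4 * π * (1 + 2 * C))) := by
  have h := tendsto_A_mul_phiLimC_plane hC 0 1
  norm_num at h
  exact h

/-- The degenerate direction `u* = k₁+2k₂+k₃` (`a = b = 1`): `A·phiLimC → 0` — no gain along `u*` (part 13: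
`phiLimC A C u* = O(A⁻²)`). [cite: Zhang2022LandauSiegel, §2 (2.8), (2.10), (2.13), (2.30)] -/
theorem tendsto_A_mul_phiLimC_uStar {C : ℝ} (hC : 0 ≤ C) :
    Tendsto (fun A : ℝ => A * phiLimC A C ![-1, 2, -1]) atTop (𝓝 0) := by
  have h := tendsto_A_mul_phiLimC_plane hC 1 1
  norm_num at h
  exact h

/-! ## The gain with an explicit remainder at finite `A` (appended) -/

/-- `|Re(a b̄)| ≤ (‖a‖² + ‖b‖²)/2` and the same for `Im`. [folklore] -/
private theorem re_im_cross_le (a b : ℂ) :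
    |(a * conj b).re| ≤ (‖a‖ ^ 2 + ‖b‖ ^ 2) / 2 ∧ |(a * conj b).im| ≤ (‖a‖ ^ 2 + ‖b‖ ^ 2) / 2 := by
  have hn : ‖a * conj b‖ = ‖a‖ * ‖b‖ := by rw [norm_mul, Complex.norm_conj]
  have hamgm : ‖a‖ * ‖b‖ ≤ (‖a‖ ^ 2 + ‖b‖ ^ 2) / 2 := by nlinarith [sq_nonneg (‖a‖ - ‖b‖)]
  refine ⟨(Complex.abs_re_le_norm _).trans ?_, (Complex.abs_im_le_norm _).trans ?_⟩ <;>
    · rw [hn]; exact hamgm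

/-- The real-variable core of the remainder estimate: with `0 < e ≤ 1`, `C, x, y ≥ 0`, `|re|, |im| ≤ (x+y)/2`,
`|(C+½+e/2)(8π(x+y−2re+eR) − 256e²·im) − 4π(1+2C)(x+y−2re)| ≤ 631(C+1)e(x+y)`,
`R = (9e−5)x + (5e+7)y + (6e+4)re`. [folklore] -/
private theorem gain_remainder_core {e C x y re im : ℝ} (he0 : 0 < e) (he1 : e ≤ 1) (hC : 0 ≤ C)
    (hx : 0 ≤ x) (hy : 0 ≤ y) (hre : |re| ≤ (x + y) / 2) (him : |im| ≤ (x + y) / 2) :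
    |(C + 1 / 2 + e / 2) *
          (8 * π * (x + y - 2 * re + e * ((9 * e - 5) * x + (5 * e + 7) * y + (6 * e + 4) * re))
            - 256 * e ^ 2 * im)
        - 4 * π * (1 + 2 * C) * (x + y - 2 * re)| ≤ 631 * (C + 1) * e * (x + y) := by
  have hre' := abs_le.mp hre
  have him' := abs_le.mp him
  have hpi := Real.pi_lt_d4
  have hpi0 := Real.pi_pos
  have hxy : 0 ≤ x + y := by linarith
  -- Step 1: the bracket `R`
  set R : ℝ := (9 * e - 5) * x + (5 * e + 7) * y + (6 * e + 4) * re with hR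
  have hR1 : |R| ≤ 19 * (x + y) := by
    have h1 : |(9 * e - 5) * x| ≤ 14 * x := by
      rw [abs_mul, abs_of_nonneg hx]
      refine mul_le_mul_of_nonneg_right ?_ hx
      rw [abs_le]; constructor <;> linarith
    have h2 : |(5 * e + 7) * y| ≤ 12 * y := by
      rw [abs_mul, abs_of_nonneg hy]
      refine mul_le_mul_of_nonneg_right ?_ hy
      rw [abs_le]; constructor <;> linarith
    have h3 : |(6 * e + 4) * re| ≤ 10 * ((x + y) / 2) := by
      rw [abs_mul]
      refine mul_le_mul ?_ hre (abs_nonneg _) (by norm_num)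
      rw [abs_le]; constructor <;> linarith
    calc |R| ≤ |(9 * e - 5) * x| + |(5 * e + 7) * y| + |(6 * e + 4) * re| := abs_add_three _ _ _
      _ ≤ 14 * x + 12 * y + 10 * ((x + y) / 2) := by linarith
      _ ≤ 19 * (x + y) := by linarith
  have hR' := abs_le.mp hR1
  -- Step 2: `T = 8πR − 256 e im`
  set T : ℝ := 8 * π * R - 256 * e * im with hT
  have hT1 : |T| ≤ (152 * π + 128) * (x + y) := by
    have h1 : |8 * π * R| ≤ 8 * π * (19 * (x + y)) := by
      rw [abs_mul, abs_of_pos (by positivity)]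
      exact mul_le_mul_of_nonneg_left hR1 (by positivity)
    have h2 : |256 * e * im| ≤ 256 * ((x + y) / 2) := by
      rw [abs_mul, abs_of_pos (by positivity)]
      calc 256 * e * |im| ≤ 256 * 1 * ((x + y) / 2) := by gcongr
        _ = 256 * ((x + y) / 2) := by ring
    calc |T| ≤ |8 * π * R| + |256 * e * im| := abs_sub _ _
      _ ≤ 8 * π * (19 * (x + y)) + 256 * ((x + y) / 2) := by linarith
      _ = (152 * π + 128) * (x + y) := by ring
  have hT' := abs_le.mp hT1
  -- Step 3: `U = 4π(x+y−2re) + (C+½+e/2)·T`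
  set U : ℝ := 4 * π * (x + y - 2 * re) + (C + 1 / 2 + e / 2) * T with hU
  have hcoef0 : 0 ≤ C + 1 / 2 + e / 2 := by linarith
  have hcoef1 : C + 1 / 2 + e / 2 ≤ C + 1 := by linarith
  have hU1 : |U| ≤ (C + 1) * ((160 * π + 128) * (x + y)) := by
    have h1 : |4 * π * (x + y - 2 * re)| ≤ 8 * π * (x + y) := by
      rw [abs_mul, abs_of_pos (by positivity)]
      have : |x + y - 2 * re| ≤ 2 * (x + y) := by rw [abs_le]; constructor <;> linarith
      calc 4 * π * |x + y - 2 * re| ≤ 4 * π * (2 * (x + y)) := by gcongr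
        _ = 8 * π * (x + y) := by ring
    have h2 : |(C + 1 / 2 + e / 2) * T| ≤ (C + 1) * ((152 * π + 128) * (x + y)) := by
      rw [abs_mul, abs_of_nonneg hcoef0]
      exact mul_le_mul hcoef1 hT1 (abs_nonneg _) (by linarith)
    have h3 : 8 * π * (x + y) ≤ (C + 1) * (8 * π * (x + y)) := by
      have h8 : 0 ≤ 8 * π * (x + y) := by positivity
      nlinarith
    calc |U| ≤ |4 * π * (x + y - 2 * re)| + |(C + 1 / 2 + e / 2) * T| := abs_add_le _ _
      _ ≤ 8 * π * (x + y) + (C + 1) * ((152 * π + 128) * (x + y)) := by linarith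
      _ ≤ (C + 1) * (8 * π * (x + y)) + (C + 1) * ((152 * π + 128) * (x + y)) := by linarith
      _ = (C + 1) * ((160 * π + 128) * (x + y)) := by ring
  -- Step 4: the difference is `e·U`
  have hdiff : (C + 1 / 2 + e / 2) * (8 * π * (x + y - 2 * re + e * R) - 256 * e ^ 2 * im)
      - 4 * π * (1 + 2 * C) * (x + y - 2 * re) = e * U := by
    rw [hU, hT]; ring
  rw [hdiff, abs_mul, abs_of_pos he0]
  have hC1 : 0 ≤ C + 1 := by linarith
  have h631 : (160 * π + 128) * (x + y) ≤ 631 * (x + y) := by nlinarith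
  calc e * |U| ≤ e * ((C + 1) * ((160 * π + 128) * (x + y))) := by gcongr
    _ ≤ e * ((C + 1) * (631 * (x + y))) := by gcongr
    _ = 631 * (C + 1) * e * (x + y) := by ring

/-- **GAIN WITH REMAINDER (every finite `A`)**: for `A > 0`, `C ≥ 0` and `ε = (C+½)/(A+C+½)` (`≤ (C+½)/A`),
`|A·phiLimC A C (a(k₁+k₂) + b(k₂+k₃)) − 4π(1+2C)‖a−b‖²| ≤ 631·(C+1)·ε·(‖a‖² + ‖b‖²)`
(`631 > 160π + 128`; a generous uniform constant — the content is the shape `O((1+C)²(‖a‖²+‖b‖²)/A)`).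
[cite: Zhang2022LandauSiegel, §2 (2.8), (2.10), (2.13), (2.30)] -/
theorem abs_A_mul_phiLimC_plane_sub_gain_le {A C : ℝ} (hA : 0 < A) (hC : 0 ≤ C) (a b : ℂ) :
    |A * phiLimC A C ![-a, a + b, -b] - 4 * π * (1 + 2 * C) * ‖a - b‖ ^ 2| ≤
      631 * (C + 1) * ((C + 1 / 2) / (A + C + 1 / 2)) * (‖a‖ ^ 2 + ‖b‖ ^ 2) := by
  obtain ⟨hre, him⟩ := re_im_cross_le a b
  have hACpos : 0 < A + C + 1 / 2 := by linarith
  have hε0 : 0 < (C + 1 / 2) / (A + C + 1 / 2) := div_pos (by linarith) hACpos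
  have hε1 : (C + 1 / 2) / (A + C + 1 / 2) ≤ 1 := by rw [div_le_one hACpos]; linarith
  rw [A_mul_phiLimC_plane hA hC, norm_sub_sq_eq_re]
  exact gain_remainder_core hε0 hε1 hC (by positivity) (by positivity) hre him

/-- The same in `1/A`-expansion shape (the `hexp` form for an F-part kept inside the first-order row):
`|phiLimC A C u − 4π(1+2C)‖a−b‖²/A| ≤ 631(C+1)(C+½)(‖a‖²+‖b‖²)/A²`.
[cite: Zhang2022LandauSiegel, §2 (2.8), (2.10), (2.13), (2.30)] -/
theorem abs_phiLimC_plane_sub_gain_div_le {A C : ℝ} (hA : 0 < A) (hC : 0 ≤ C) (a b : ℂ) :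
    |phiLimC A C ![-a, a + b, -b] - 4 * π * (1 + 2 * C) * ‖a - b‖ ^ 2 / A| ≤
      631 * (C + 1) * (C + 1 / 2) * (‖a‖ ^ 2 + ‖b‖ ^ 2) / A ^ 2 := by
  have h := abs_A_mul_phiLimC_plane_sub_gain_le hA hC a b
  have hε : (C + 1 / 2) / (A + C + 1 / 2) ≤ (C + 1 / 2) / A :=
    div_le_div_of_nonneg_left (by linarith) hA (by linarith)
  have hs : 0 ≤ ‖a‖ ^ 2 + ‖b‖ ^ 2 := by positivity
  have hC1 : 0 ≤ 631 * (C + 1) := by positivity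
  have h2 : |A * phiLimC A C ![-a, a + b, -b] - 4 * π * (1 + 2 * C) * ‖a - b‖ ^ 2| ≤
      631 * (C + 1) * ((C + 1 / 2) / A) * (‖a‖ ^ 2 + ‖b‖ ^ 2) :=
    h.trans (mul_le_mul_of_nonneg_right (mul_le_mul_of_nonneg_left hε hC1) hs)
  have hkey : phiLimC A C ![-a, a + b, -b] - 4 * π * (1 + 2 * C) * ‖a - b‖ ^ 2 / A =
      (A * phiLimC A C ![-a, a + b, -b] - 4 * π * (1 + 2 * C) * ‖a - b‖ ^ 2) / A := by
    field_simp
  rw [hkey, abs_div, abs_of_pos hA, div_le_iff₀ hA]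
  refine h2.trans (le_of_eq ?_)
  field_simp

end EllRegime

end Literature.NumberTheory.LFunctions.Zhang2022
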